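import Summits.QuantumFields.YangMills.Theses.CertificationLength
import Summits.QuantumFields.YangMills.Theses.IsotropyFromPowerCounting
import Summits.QuantumFields.YangMills.Theorems.MirrorModularBoostsSoftKernelBoostCovarianceBelowThresholdOfSoftKernel
import Summits.QuantumFields.YangMills.Theorems.PencilRigidityNPointIsotropyPlanarInvariantOfInputsRadial
import Summits.QuantumFields.YangMills.Theorems.IsotropyFromPowerCountingEngineFromPowerCounting

/-!
# Birth skeleton (BC3) for the crux `NPointIsotropyBelowThreshold` — stmt-QuantumFields-15892

Route `CertificationLength` (route-QuantumFields-CertificationLength, crux (N′), rank 6; sub-problem `YangMills`, Statement decl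
`_root_.YangMills`).  Planner `planner-skel-stmt-QuantumFields-15892-0`, 2026-08-17 (mode skeleton-register, re-audit bin
REPAIRABLE).  Published as `Summits/QuantumFields/YangMills/Cruxes/NPointIsotropyBelowThreshold/Lines/birth.lean`.

## The crux

(N′) `NPointIsotropyBelowThreshold`: for every compact simple `G`, `r`, `sch` and one-species family `S₁` carrying the curvature
package `W₁` (lattice tie; E0, E0′, E2, E3, E4; translations and proper signed permutations on `⁰𝒮`; continuum and uniform lattice
gap), reflection positive in pull-back form in the eight planar frames, and whose two-point function on `⁰𝒮` is a REAL kernel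
`K(x₀ − x₁)`, continuous off `0`, with `|K x| ≤ C (1 + ‖x‖^(η−10))`, `η > 0` (the soft kernel triple = the conclusion of
`CurvatureKernelBound`): every `S₁ n` is invariant on `⁰𝒮` under the determinant-one isometries fixing `e₂, e₃`.  Unbundled
(landed, `Iff.rfl`): `nPointIsotropyBelowThreshold_iff : (N′) ↔ ∀ G …, W1 r sch S₁ → EightFrameRP S₁ → SoftKernel S₁ → PlanarInvariant S₁`.

What the tree already knows about (N′) (all LANDED, sorry-free; `Theorems/MirrorModularBoostsSoftKernelBoostCovarianceBelowThresholdOfSoftKernel.lean`):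
(N′) ↔ `MirrorModularBoosts.SoftKernelBoostCovariance` (stmt-QuantumFields-14999; the planar cone is free by the closed item 9664),
`PencilRigidity.NPointIsotropy` (stmt-11686) → (N′) (the soft kernel is RADIAL: `radialKernel_of_softKernel` = the closed items
KernelTransfer 11688 + ShellRigidity 11685), and crux 14999's line `Sketch` (v3.9, terminal) reduced 14999 — hence (N′) — to the two
Yang–Mills UV inputs filed as items of route `IsotropyFromPowerCounting`: Step 0 / T (`CurvatureDensities` stmt-17723 ⇐
`TemperedCurvatureMoments` stmt-17721) and the transversely filtered heat-sandwich bound Σ (`CurvatureSandwichBound`, stmt-18372), the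
typed split `EngineFromPowerCounting : T → Σ → 14999` being PROVED (stmt-17722, `engineFromPowerCounting_proof`).

## The cut: Step 0 + the sandwich bound ROW BY ROW, the 45° row WITHOUT its threshold

(N′) carries the soft kernel, which the landed KernelTransfer + ShellRigidity make radial; under a radial kernel the level growth at
levels `≤ 1` of the complex-rotation sieve is free (`levelGrowthLow_shape`), so the landed POINTWISE radial composition
`stub_planarInvariantOfInputsRadial` (generation 12 of crux 11686's line) consumes, for ONE family: Step 0 (`NPointRegular S₁`), the
`e₀`-row of Σ with SOME exponent `μ < 4` (typed boost vectors kill the layers `|k| ≥ 2` — this is where "tr F² has dimension 4 < 5"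
enters), and the `45°`-row of Σ with ANY exponent (uniform boost vectors of the diagonal pull-back feed only ray positivity).  Hence the
three stubs — each a Yang–Mills UV statement about the Wilson limit of the curvature channel entering only through the tie, each
WEAKER than or equal to an existing item, none of them (N′), 14999, 11686, 9663 or the summit:

* `stub_curvatureDensities : IsotropyFromPowerCounting.CurvatureDensities` — STEP 0, the item stmt-QuantumFields-17723 BY NAME: for
  every tied family with the eight frames and the cone, every `𝔖ₙ|⁰𝒮` is integration against a function (`NPointRegular`).  A corollary
  of T = stmt-17721 (landed `curvatureDensities_of_temperedCurvatureMoments`); its Yang–Mills content is the degrees `n ≥ 3` of T in the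
  regime `sup_k |c_k| = ∞` (crux 14999's skeleton v3.9: degree 1 on every tied scheme, degree 2 = the kernel triple, both landed).
  Why it might fail: `W1` pins neither asymptotic freedom nor the scaling of `c_k`; only `c ≡ 0` / `β ≡ 0` / bounded-`c` inhabitants are
  certified.  Junk families violate it (`not_nPointRegular_junk`) — the tie is load-bearing here.  Size: XL (UV).
* `stub_axisSandwichBound : AxisSandwichBound` — the `e₀`-ROW of Σ, verbatim the first conjunct of stmt-18372 with its antecedents
  (`W1 → EightFrameRP → PlanarCone → soft kernel triple →`): for every `e₀`-reconstruction `h` of `S₁` some `μ < 4` and `C` with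
  `‖Ψ(f₁ ⊗ T_{(2u+v)e₀} W)‖ ≤ C·Mg·(Mh+Mh')·(u^{−μ}+v^{−μ})·‖Ψ(W)‖` for all `0 < u, v ≤ 1`, `f₁ = g(x₀,x₁) hh(x₂,x₃)` with `g`
  supported in the time window `[u, 2u]`, `∫|g| ≤ Mg`, `∫|hh| ≤ Mh`, `|hh| ≤ Mh'`, all time-ordered `W`.  Vacuum row = the kernel
  triple with `μ₀ = 4 − η/2` (landed calibration `stub_sandwichVacuumRowOfKernel`); power counting for `tr F²`: `μ = 3`.  Why it might
  fail: a gapped Wilson limit whose `tr F²` four-point function scales with dimension `≥ 5` obeys `W1` and the kernel triple and refutes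
  it.  Size: XL (THE BET of cruxes 9663 / 11686 / 14999 / 15892).
* `stub_diagonalSandwichBound : DiagonalSandwichBound` — the `45°`-ROW of Σ WITHOUT THE THRESHOLD: the second conjunct of stmt-18372
  (rotation `R` of the `(x₀,x₁)`-plane named by its coordinates, Mathlib-only) with `μ < 4 ∧` DELETED — for every `e₀`-reconstruction
  `h'` of the pull-back `n ↦ 𝔖ₙ ∘ (R ·)` SOME exponent `μ` and constant `C` with the same sandwich inequality.  New relative to the
  items (the thinning crux 11686's lead c6 asked for, "11686 needs LESS than 18372 in the 45° frame (any exponent)"; it holds for (N′)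
  because the soft kernel is radial): a polynomial heat-sandwich bound for the ROUGHLY smeared field in the DIAGONAL frame, which needs
  the diagonal transfer matrix on the lattice side and cannot be transported from the `e₀` frame before rotation invariance is proved.
  Why it might fail: as for the `e₀` row, in the diagonal frame (FILS diagonal mirrors of the Wilson action give RP, not yet a
  `k`-uniform operator bound).  Size: L–XL.

Composition `NPointIsotropyBelowThreshold_of : stub₁ → stub₂ → stub₃ → (N′)` (hypotheses spelled `__Registered.stub_X`, `rfl`-aliases
keyed by the stub names, for the native audit `#h21_check_skeleton`) is PROVED below without `sorry`: unbundle (N′)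
(`nPointIsotropyBelowThreshold_iff`), fix `G` with its Borel structure, `r, sch, S₁`, `hW : W1 r sch S₁`, the eight frames `h8` and the soft
kernel `hK`; the planar cone is `planarCone_of_W1 hW h8` (closed item 9664), the kernel is radial by `radialKernel_of_softKernel` (closed
items 11688 + 11685), Step 0 gives `NPointRegular S₁`, the two rows give the two sandwich inputs (the `45°` row instantiated at
`planeRot 0 (π/4)`, whose coordinates are the named ones: `planeRot_coords_quarter_pi`), and `stub_planarInvariantOfInputsRadial`
concludes `PlanarInvariant S₁`.  It concludes the route decl `Summit.QuantumFields.YangMills.Theses.CertificationLength.NPointIsotropyBelowThreshold`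
BY NAME.  Also recorded (sorry-free): `NPointIsotropyBelowThreshold_of'` (the closed form over the three registered stubs), the one-line
closure of each row stub by the item Σ (`axisSandwichBound_of_curvatureSandwichBound`, `diagonalSandwichBound_of_curvatureSandwichBound`),
and the BY-NAME closure recipes over EXISTING ITEMS — `NPointIsotropyBelowThreshold_of_items : CurvatureDensities → CurvatureSandwichBound → (N′)`
and `NPointIsotropyBelowThreshold_of_cruxes : TemperedCurvatureMoments → CurvatureSandwichBound → (N′)` (the second also available as
`stub_belowThresholdOfSoftKernel ∘ engineFromPowerCounting_proof`): closing stmt-18372 together with stmt-17723 (or stmt-17721) closes this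
crux, crux 14999 and — with `CurvatureKernelBound` stmt-11687 — cruxes 11686 and 9663 (`cruxWeb_of_kernelBound`).

Exactness / no strength lost: stub₂ ∧ stub₃ ⇐ Σ (stmt-18372) by projection and stub₁ ⇐ T (stmt-17721) by the landed glue, so the
skeleton asks NOT MORE than the filed items; conversely no stub follows from (N′) (rotation invariance of `𝔖ₙ|⁰𝒮` gives neither
densities nor heat-sandwich operator bounds), and no stub gives (N′) or `YangMills` on its own (BC3 probes below).

BC3 audit (planner folder `bc/`, farm `lean check --json`, 2026-08-17): this file rc 0, errors [], sorries 3 — the three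
`declaration uses 'sorry'` warnings sit exactly on the three `stub_*` theorem lines and nowhere else;
`--axioms NPointIsotropyBelowThreshold_of` = [propext, Classical.choice, Quot.sound] (no `sorryAx`; the H21 file audit classifies
`NPointIsotropyBelowThreshold_of_items` / `_of_cruxes` / `_of_cruxes'` as sorry-free proofs of the route item under registered
hypotheses).  Probes (`bc/<Stub>_probe.lean`: the imports of this file but NOT this file — the whole landed sieve and the transfer web
14999 ↔ (N′) ← 11686 ← 9663 in scope, no sorried `stub_*` — with the two row statements restated as defs; 12 examples each): for every
stub statement `S ∈ {CurvatureDensities, AxisSandwichBound, DiagonalSandwichBound}` both `S → NPointIsotropyBelowThreshold` and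
`S → _root_.YangMills` by `first | exact? | simpa [S] | (unfold S; simpa) | aesop` FAIL — combined form and each alternative separately
(`exact?`: "could not close the goal" 6/6; `aesop`: "failed to prove the goal after exhaustive search" / unsolved goals 6/6; `simpa [S]`
and `unfold S; simpa`: `assumption` failed on the unfolded goal for `CurvatureDensities` 4/4 and heartbeat-exhausted at `whnf` under
`maxHeartbeats 400000` for the two rows 8/8; combined: exhausted at `whnf` 6/6) — and `intro h; exact h` is a type mismatch 6/6:
36/36 probes fail, no stub is cheaply the crux or the summit (rc 1 each; wall 257 s / 368 s / 288 s).

Disproof used (crux 14999 ≡ (N′); this crux has no workfiles of its own, `ledger crux ls stmt-QuantumFields-15892` 2026-08-17):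
`Cruxes/SoftKernelBoostCovariance/Disproof.lean` + landed `Theorems/SoftKernelBoostCovariance/Negative/TieLoadBearing.lean` —
`softKernelBoostCovariance_false_without_tie` / `_false_without_tieAt4` / `_false_without_lattice` (`not_softKernelModelBlind`): any proof
must use the lattice tie — honoured: every stub keeps the antecedent `W1 r sch S₁` (tie included) and Step 0 is exactly where the tie
bites (junk families satisfy Σ with `C = 0`, `sandwichBound_junk`, and violate `NPointRegular`, `not_nPointRegular_junk`);
`not_softKernelBoostCovarianceOnAllTests`: every conclusion here stays on `⁰𝒮`.  Negatives index (`ledger negatives --problem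
QuantumFields`, 5 entries: 4 QCD, 1 = MirrorModularBoosts' `DiagonalMirrorRP` stmt-9665): none concerns sandwich bounds or lattice
moment densities; no stub is an instance of a landed Negative lemma (the `Negative/` lemmas of 14999 / 11686 / 9663 refute tie-free,
model-blind, all-tests and band-limit variants, none of which is a stub here).
-/

namespace Summit.QuantumFields.YangMills.Cruxes.NPointIsotropyBelowThreshold.Birth

open scoped BigOperators SchwartzMap
open MeasureTheory Filter Topology
open Literature.MathematicalPhysics.QuantumLattice Literature.MathematicalPhysics.AQFT
  Literature.MathematicalPhysics.QuantumFieldTheory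
open Summit.QuantumFields.YangMills.Theorems.NPointIsotropy.Negative (E4 NPointRegular RadialKernel)
open Summit.QuantumFields.YangMills.Theorems.CurvatureBoostCovariance.Negative
  (OSPackage Translations Hypercubic EightFrameRP PlanarCone PlanarInvariant Tie Gaps W1)
open Summit.QuantumFields.YangMills.Theorems.SoftKernelBoostCovariance.Negative (SoftKernel)
open Summit.QuantumFields.YangMills.Theorems.SoftKernelBoostCovariance.Sketch
  (nPointIsotropyBelowThreshold_iff radialKernel_of_softKernel planeRot_coords_quarter_pi
    stub_belowThresholdOfSoftKernel engineFromPowerCounting_proof curvatureDensities_of_temperedCurvatureMoments)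
open Summit.QuantumFields.YangMills.Theorems.NPointIsotropy.ComplexRotationBandlimit
  (planarCone_of_W1 stub_planarInvariantOfInputsRadial)

/-! ## Stub statements

Step 0 is the item `IsotropyFromPowerCounting.CurvatureDensities` itself (by name).  The two sandwich rows are stated here, in the
item's own Mathlib-only vocabulary (the `45°` frame named by coordinates), so that a prover can restate either row in `Theorems/`
without importing this file. -/

/-- **Stub statement 2 — the `e₀`-row of the sandwich bound Σ** (verbatim the first conjunct of `IsotropyFromPowerCounting.CurvatureSandwichBound`,
stmt-QuantumFields-18372, with its antecedents): for every compact simple `G` (any Borel structure), `r`, `sch`, `S₁` with `W1 r sch S₁`,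
the eight planar frames, the planar cone and the soft two-point kernel triple, and every `e₀`-reconstruction `h` of `S₁`: some `μ < 4`
and `C` with the transversely filtered heat-sandwich bound on all time-ordered `W`. -/
def AxisSandwichBound : Prop :=
  open Literature.MathematicalPhysics.QuantumLattice Literature.MathematicalPhysics.AQFT Literature.MathematicalPhysics.QuantumFieldTheory Literature.Probability.LatticeModels Summit.QuantumFields.YangMills.Theorems.CurvatureBoostCovariance.Negative Summit.QuantumFields.YangMills.Theorems.NPointIsotropy.Negative in ∀ (G : Type) [Group G] [TopologicalSpace G] [IsTopologicalGroup G] [CompactSpace G] [MeasurableSpace G] [BorelSpace G], IsCompactSimpleLieGroup G → ∀ (r : LatticeRep G) (sch : SpeciesScheme (YMSpecies G)) (S₁ : SchwingerFamily E4), W1 r sch S₁ → EightFrameRP S₁ → PlanarCone S₁ → (∃ (K : E4 → ℝ) (C η : ℝ), 0 < η ∧ ContinuousOn K {x : E4 | x ≠ 0} ∧ (∀ x : E4, x ≠ 0 → |K x| ≤ C * (1 + ‖x‖ ^ (η - 10))) ∧ ∀ F : SchwartzMap (Fin 2 → E4) ℂ, IsOffDiagonal F → MeasureTheory.Integrable (fun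 x : Fin 2 → E4 => (K (x 0 - x 1) : ℂ) * F x) ∧ S₁ 2 F = ∫ x : Fin 2 → E4, (K (x 0 - x 1) : ℂ) * F x) → ∀ (h : OSReconstructionNoE1 S₁.toLabelled), ∃ μ C : ℝ, μ < 4 ∧ (∀ (u v : ℝ), 0 < u → 0 < v → u ≤ 1 → v ≤ 1 → ∀ (f₁ : SchwartzMap (Fin 1 → E4) ℂ) (g hh : ℝ × ℝ → ℂ) (Mg Mh Mh' : ℝ), (∀ x : Fin 1 → E4, f₁ x = g (x 0 0, x 0 1) * hh (x 0 2, x 0 3)) → (∀ p : ℝ × ℝ, g p ≠ 0 → u ≤ p.1 ∧ p.1 ≤ 2 * u) → MeasureTheory.Integrable g → (∫ p, ‖g p‖) ≤ Mg → MeasureTheory.Integrable hh → (∫ p, ‖hh p‖) ≤ Mh → (∀ p, ‖hh p‖ ≤ Mh') → ∀ (n : ℕ) (W : SchwartzMap (Fin n → E4) ℂ) (hW : IsTimeOrdered W) (hFW : IsTimeOrdered (SchwartzMap.appendTensor f₁ (translateMulti ((2 * u + v) • EuclideanSpace.single 0 1) W))), ‖h.fieldVec (1 + n) (fun _ => ())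 (SchwartzMap.appendTensor f₁ (translateMulti ((2 * u + v) • EuclideanSpace.single 0 1) W)) hFW‖ ≤ C * Mg * (Mh + Mh') * (u ^ (-μ) + v ^ (-μ)) * ‖h.fieldVec n (fun _ => ()) W hW‖)

/-- **Stub statement 3 — the `45°`-row of Σ WITHOUT THE THRESHOLD** (the second conjunct of stmt-QuantumFields-18372 with `μ < 4 ∧`
deleted): same antecedents; for every linear isometry `R` with `(Rx)₀ = cos(π/4)x₀ + sin(π/4)x₁`, `(Rx)₁ = −sin(π/4)x₀ + cos(π/4)x₁`,
`(Rx)₂ = x₂`, `(Rx)₃ = x₃` and every `e₀`-reconstruction `h'` of the pull-back family `n ↦ 𝔖ₙ ∘ (R ·)`: SOME exponent `μ` and constant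
`C` with the same sandwich bound.  Enough for (N′) because its soft kernel is radial (levels `≤ 1` free), so the diagonal frame feeds
only ray positivity (uniform boost vectors, any exponent). -/
def DiagonalSandwichBound : Prop :=
  open Literature.MathematicalPhysics.QuantumLattice Literature.MathematicalPhysics.AQFT Literature.MathematicalPhysics.QuantumFieldTheory Literature.Probability.LatticeModels Summit.QuantumFields.YangMills.Theorems.CurvatureBoostCovariance.Negative Summit.QuantumFields.YangMills.Theorems.NPointIsotropy.Negative in ∀ (G : Type) [Group G] [TopologicalSpace G] [IsTopologicalGroup G] [CompactSpace G] [MeasurableSpace G] [BorelSpace G], IsCompactSimpleLieGroup G → ∀ (r : LatticeRep G) (sch : SpeciesScheme (YMSpecies G)) (S₁ : SchwingerFamily E4), W1 r sch S₁ → EightFrameRP S₁ → PlanarCone S₁ → (∃ (K : E4 → ℝ) (C η : ℝ), 0 < η ∧ ContinuousOn K {x : E4 | x ≠ 0} ∧ (∀ x : E4, x ≠ 0 → |K x| ≤ C * (1 + ‖x‖ ^ (η - 10))) ∧ ∀ F : SchwartzMap (Fin 2 → E4) ℂ, IsOffDiagonal F → MeasureTheory.Integrable (fun x : Fin 2 →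 E4 => (K (x 0 - x 1) : ℂ) * F x) ∧ S₁ 2 F = ∫ x : Fin 2 → E4, (K (x 0 - x 1) : ℂ) * F x) → ∀ (R : E4 ≃ₗᵢ[ℝ] E4), (∀ x : E4, R x 0 = Real.cos (Real.pi / 4) * x 0 + Real.sin (Real.pi / 4) * x 1 ∧ R x 1 = -Real.sin (Real.pi / 4) * x 0 + Real.cos (Real.pi / 4) * x 1 ∧ R x 2 = x 2 ∧ R x 3 = x 3) → ∀ (h' : OSReconstructionNoE1 (SchwingerFamily.toLabelled (fun n => (S₁ n).comp (linActMulti R)))), ∃ μ C : ℝ, (∀ (u v : ℝ), 0 < u → 0 < v → u ≤ 1 → v ≤ 1 → ∀ (f₁ : SchwartzMap (Fin 1 → E4) ℂ) (g hh : ℝ × ℝ → ℂ) (Mg Mh Mh' : ℝ), (∀ x : Fin 1 → E4, f₁ x = g (x 0 0, x 0 1) * hh (x 0 2, x 0 3)) → (∀ p : ℝ × ℝ, g p ≠ 0 → u ≤ p.1 ∧ p.1 ≤ 2 * u) → MeasureTheory.Integrable g → (∫ p, ‖g p‖) ≤ Mg → MeasureTheory.Integrable hh → (∫ p, ‖hh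 p‖) ≤ Mh → (∀ p, ‖hh p‖ ≤ Mh') → ∀ (n : ℕ) (W : SchwartzMap (Fin n → E4) ℂ) (hW : IsTimeOrdered W) (hFW : IsTimeOrdered (SchwartzMap.appendTensor f₁ (translateMulti ((2 * u + v) • EuclideanSpace.single 0 1) W))), ‖h'.fieldVec (1 + n) (fun _ => ()) (SchwartzMap.appendTensor f₁ (translateMulti ((2 * u + v) • EuclideanSpace.single 0 1) W)) hFW‖ ≤ C * Mg * (Mh + Mh') * (u ^ (-μ) + v ^ (-μ)) * ‖h'.fieldVec n (fun _ => ()) W hW‖)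

/-! ## The three registered stubs (the ONLY `sorry`s of this file) -/

/-- Registered stub 1: STEP 0 = the item `IsotropyFromPowerCounting.CurvatureDensities` (stmt-QuantumFields-17723), by name. -/
theorem stub_curvatureDensities :
    Summit.QuantumFields.YangMills.Theses.IsotropyFromPowerCounting.CurvatureDensities := by
  sorry

/-- Registered stub 2: the `e₀`-row of Σ with exponent `μ < 4`. -/
theorem stub_axisSandwichBound : AxisSandwichBound := by
  sorry

/-- Registered stub 3: the `45°`-row of Σ with any exponent. -/
theorem stub_diagonalSandwichBound : DiagonalSandwichBound := by
  sorry

/-! ## Name-keyed aliases of the stub statements — the hypotheses of `NPointIsotropyBelowThreshold_of`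

The native skeleton audit admits a hypothesis of the skeleton theorem only if its head constant is a registered obligation or is
NAMED like a declared stub; `__Registered.stub_X` is the statement of `stub_X` under that name (device of the earlier `Lines/birth.lean`
files).  Each alias is `rfl`-equal to its statement. -/
namespace __Registered

/-- Alias of `IsotropyFromPowerCounting.CurvatureDensities` keyed by the registered stub name. -/
abbrev stub_curvatureDensities : Prop :=
  Summit.QuantumFields.YangMills.Theses.IsotropyFromPowerCounting.CurvatureDensities
/-- Alias of `AxisSandwichBound` keyed by the registered stub name. -/
abbrev stub_axisSandwichBound : Prop := AxisSandwichBound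
/-- Alias of `DiagonalSandwichBound` keyed by the registered stub name. -/
abbrev stub_diagonalSandwichBound : Prop := DiagonalSandwichBound

end __Registered

/-! ## Composition: the crux BY NAME from the three stub statements (no `sorry` below) -/

/-- **NPointIsotropyBelowThreshold_of** — Step 0, the `e₀`-row (`μ < 4`) and the threshold-free `45°`-row of the sandwich bound imply
the crux (N′): unbundle, supply the cone (closed 9664) and the radiality of the soft kernel (closed 11688 + 11685), and run the landed
pointwise radial composition `stub_planarInvariantOfInputsRadial` of the complex-rotation sieve.  Conclusion = the route decl, by name. -/
theorem NPointIsotropyBelowThreshold_of (h0 : __Registered.stub_curvatureDensities)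
    (hA : __Registered.stub_axisSandwichBound) (hD : __Registered.stub_diagonalSandwichBound) :
    Summit.QuantumFields.YangMills.Theses.CertificationLength.NPointIsotropyBelowThreshold := by
  rw [nPointIsotropyBelowThreshold_iff]
  intro G _ _ _ _ hG
  letI : MeasurableSpace G := borel G
  haveI : BorelSpace G := ⟨rfl⟩
  intro r sch S₁ hW h8 hK
  -- the planar spectral cone is a theorem under `W1` and the eight frames (closed item 9664)
  have hC : PlanarCone S₁ := planarCone_of_W1 hW h8
  -- Step 0: every `𝔖ₙ|⁰𝒮` is a function
  have hreg : NPointRegular S₁ := h0 G hG r sch S₁ hW h8 hC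
  -- the soft kernel is radial (KernelTransfer 11688 + ShellRigidity 11685, closed)
  have hrad : RadialKernel S₁ := radialKernel_of_softKernel hW.2.1.2.2.2.2.1 hW.2.2.2.1 h8 hK
  -- the two sandwich rows: `e₀` with `μ < 4`, `45°` (at `planeRot 0 (π/4)`, named by its coordinates) with any exponent
  have hSig := hA G hG r sch S₁ hW h8 hC hK
  have h45 := hD G hG r sch S₁ hW h8 hC hK (planeRot (0 : Fin 3) (Real.pi / 4)) planeRot_coords_quarter_pi
  obtain ⟨-, hOS, htr, hhyp, -⟩ := hW
  exact stub_planarInvariantOfInputsRadial S₁ hOS htr hhyp h8 hC hrad hreg hSig h45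

/-- **The closed form over the registered stubs** (the three `sorry`s above are the only gaps). -/
theorem NPointIsotropyBelowThreshold_of' :
    Summit.QuantumFields.YangMills.Theses.CertificationLength.NPointIsotropyBelowThreshold :=
  NPointIsotropyBelowThreshold_of stub_curvatureDensities stub_axisSandwichBound stub_diagonalSandwichBound

/-! ## By-name closure paths over EXISTING ITEMS (sorry-free) -/

/-- The item Σ (`IsotropyFromPowerCounting.CurvatureSandwichBound`, stmt-QuantumFields-18372) closes stub 2 by projection. -/
theorem axisSandwichBound_of_curvatureSandwichBound
    (hS : Summit.QuantumFields.YangMills.Theses.IsotropyFromPowerCounting.CurvatureSandwichBound) : AxisSandwichBound := by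
  intro G _ _ _ _ _ _ hG r sch S₁ hW h8 hC hK
  exact (hS G hG r sch S₁ hW h8 hC hK).1

/-- The item Σ (stmt-QuantumFields-18372) closes stub 3 by projection (forget the threshold `μ < 4` of its `45°` conjunct). -/
theorem diagonalSandwichBound_of_curvatureSandwichBound
    (hS : Summit.QuantumFields.YangMills.Theses.IsotropyFromPowerCounting.CurvatureSandwichBound) : DiagonalSandwichBound := by
  intro G _ _ _ _ _ _ hG r sch S₁ hW h8 hC hK R hR h'
  obtain ⟨μ, C, -, h⟩ := (hS G hG r sch S₁ hW h8 hC hK).2 R hR h'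
  exact ⟨μ, C, h⟩

/-- **(N′) from two existing ITEMS, by name**: Step 0 (`CurvatureDensities`, stmt-QuantumFields-17723) and Σ (`CurvatureSandwichBound`,
stmt-QuantumFields-18372). -/
theorem NPointIsotropyBelowThreshold_of_items
    (hD : Summit.QuantumFields.YangMills.Theses.IsotropyFromPowerCounting.CurvatureDensities)
    (hS : Summit.QuantumFields.YangMills.Theses.IsotropyFromPowerCounting.CurvatureSandwichBound) :
    Summit.QuantumFields.YangMills.Theses.CertificationLength.NPointIsotropyBelowThreshold :=
  NPointIsotropyBelowThreshold_of hD (axisSandwichBound_of_curvatureSandwichBound hS)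
    (diagonalSandwichBound_of_curvatureSandwichBound hS)

/-- **(N′) from two existing CRUXES, by name**: T (`TemperedCurvatureMoments`, stmt-QuantumFields-17721) and Σ (stmt-QuantumFields-18372) —
Step 0 from T by the landed `curvatureDensities_of_temperedCurvatureMoments`.  (Equivalently `stub_belowThresholdOfSoftKernel
(engineFromPowerCounting_proof hT hS)`: the proved engine item stmt-17722 followed by the landed transfer 14999 → (N′); recorded as
`NPointIsotropyBelowThreshold_of_cruxes'`.)  When `…TemperedCurvatureMoments_holds` and `…CurvatureSandwichBound_holds` exist this is the
closing one-liner of the crux. -/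
theorem NPointIsotropyBelowThreshold_of_cruxes
    (hT : Summit.QuantumFields.YangMills.Theses.IsotropyFromPowerCounting.TemperedCurvatureMoments)
    (hS : Summit.QuantumFields.YangMills.Theses.IsotropyFromPowerCounting.CurvatureSandwichBound) :
    Summit.QuantumFields.YangMills.Theses.CertificationLength.NPointIsotropyBelowThreshold :=
  NPointIsotropyBelowThreshold_of_items (curvatureDensities_of_temperedCurvatureMoments hT) hS

/-- The same through the proved engine item `EngineFromPowerCounting` (stmt-QuantumFields-17722) and the landed transfer
`SoftKernelBoostCovariance → NPointIsotropyBelowThreshold`. -/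
theorem NPointIsotropyBelowThreshold_of_cruxes'
    (hT : Summit.QuantumFields.YangMills.Theses.IsotropyFromPowerCounting.TemperedCurvatureMoments)
    (hS : Summit.QuantumFields.YangMills.Theses.IsotropyFromPowerCounting.CurvatureSandwichBound) :
    Summit.QuantumFields.YangMills.Theses.CertificationLength.NPointIsotropyBelowThreshold :=
  stub_belowThresholdOfSoftKernel (engineFromPowerCounting_proof hT hS)

end Summit.QuantumFields.YangMills.Cruxes.NPointIsotropyBelowThreshold.Birth
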